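import Literature.MeasureTheory.RestrictedProduct.QuotientMeasureNormalized
import Literature.MeasureTheory.RestrictedProduct.CylinderSlices
import Literature.NumberTheory.Automorphic.CanonicalTorusMeasureTransport
import HarnessLib

/-!
# Restricted product measures, XIV: a componentwise isomorphism carrying `ν_i` to `ν′_i` carries `∏'(ν_i ; B_i)` to `∏'(ν′_i ; B′_i)`
(Tate, in Cassels–Fröhlich (1967) Ch. XV §3.3: `dα = ∏ dα_𝔭` is functorial in the local data; Rogawski (1990) §4.3 p. 43: «Haar measures on
stably conjugate tori chosen compatibly» — place by place, hence adelically)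

Topic `MeasureTheory/RestrictedProduct`; THEOREMS ONLY (no definition, no instance, no named fact).  For locally compact second countable
groups `G_i`, `G′_i` with compact open subgroups `B_i`, `B′_i`, Haar measures `ν_i`, `ν′_i` normalised by `ν_i(B_i) = 1 = ν′_i(B′_i)` off a
finite `S₀`, and an isomorphism of topological groups `Φ : Πʳ(G_i ; B_i) ≃ₜ* Πʳ(G′_i ; B′_i)` which is COMPONENTWISE (`(Φ x)_i = φ_i(x_i)`) with
`φ_i⁻¹(B′_i) = B_i` off `S₀` and `(φ_i)_* ν_i = ν′_i` for all `i`: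

* **`map_rpMeasure_eq_rpMeasure_of_componentwise`** — `Φ_* ∏'(ν_i ; B_i) = ∏'(ν′_i ; B′_i)`.  Proof: both sides are Haar measures on
  `Πʳ(G′_i ; B′_i)` (★ `isHaarMeasure_rpMeasure`, Mathlib `MulEquiv.isHaarMeasure_map`); on the compact open integral box `∏_i B′_i` the left
  side has mass `∏_{i∈S₀} ν_i(φ_i⁻¹ B′_i) = ∏_{i∈S₀} ν′_i(B′_i)` (★ `rpMeasure_setOf_forall_mem_eq_prod`, the box with finitely many modified
  factors), the mass of the right side.

WHY.  Step (δ2) of (O-W) on the F0/P3a line: the adelic torus measures `⊗_v t_v` at two stably conjugate regular classes correspond under the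
adelic stable-centraliser isomorphism (★ `adelicStableCentralizerEquiv`) because the canonical local torus measures do (★
`CanonicalTorusMeasureTransport.map_eq_of_apply_compactCore_eq_one`), whence equal covolumes (★ `LatticeCovolumeTransport`).

## References
* J. W. S. Cassels, A. Fröhlich (eds.), *Algebraic Number Theory* (1967), Ch. XV (Tate) §3.3 [CasselsFrohlichANT1967].
* J. D. Rogawski, *Automorphic Representations of Unitary Groups in Three Variables* (1990), §4.3 p. 43 [Rogawski1990].
-/

set_option autoImplicit false

noncomputable section

open _root_.MeasureTheory _root_.MeasureTheory.Measure Set Filter Function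
open _root_.Topology
open scoped RestrictedProduct ENNReal NNReal Pointwise

namespace Literature.MeasureTheory.RestrictedProduct

universe u v w


section Componentwise

variable {ι : Type u} [Countable ι] {G : ι → Type v} {G' : ι → Type w}
  [∀ i, Group (G i)] [∀ i, TopologicalSpace (G i)] [∀ i, IsTopologicalGroup (G i)]
  [∀ i, SecondCountableTopology (G i)] [∀ i, T2Space (G i)] [∀ i, MeasurableSpace (G i)] [∀ i, BorelSpace (G i)]
  [∀ i, Group (G' i)] [∀ i, TopologicalSpace (G' i)] [∀ i, IsTopologicalGroup (G' i)]
  [∀ i, SecondCountableTopology (G' i)] [∀ i, T2Space (G' i)] [∀ i, MeasurableSpace (G' i)] [∀ i, BorelSpace (G' i)]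
  (B : ∀ i, Subgroup (G i)) (B' : ∀ i, Subgroup (G' i))
  [hBo : Fact (∀ i, IsOpen (B i : Set (G i)))] [hB'o : Fact (∀ i, IsOpen (B' i : Set (G' i)))]
  [hBc : ∀ i, CompactSpace (B i)] [hB'c : ∀ i, CompactSpace (B' i)]
  [BorelSpace (Πʳ i, [G i, B i])] [BorelSpace (Πʳ i, [G' i, B' i])] [SecondCountableTopology (Πʳ i, [G' i, B' i])]
  (ν : ∀ i, Measure (G i)) [∀ i, (ν i).IsHaarMeasure] [∀ i, SigmaFinite (ν i)]
  (ν' : ∀ i, Measure (G' i)) [∀ i, (ν' i).IsHaarMeasure] [∀ i, SigmaFinite (ν' i)]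
  (S₀ : Finset ι)

/-- **A componentwise isomorphism carrying `ν_i` to `ν′_i` carries `∏'(ν_i ; B_i)` to `∏'(ν′_i ; B′_i)`.**  Hypotheses: `ν_i(B_i) = 1` and
`ν′_i(B′_i) = 1` off `S₀`; `Φ : Πʳ(G_i ; B_i) ≃ₜ* Πʳ(G′_i ; B′_i)` with `(Φ x)_i = φ_i(x_i)` for measurable `φ_i`, `φ_i⁻¹(B′_i) = B_i` off `S₀`, and
`(φ_i)_* ν_i = ν′_i` for all `i`.  Then `Φ_* ∏'(ν_i ; B_i) = ∏'(ν′_i ; B′_i)`. [cite: CasselsFrohlichANT1967, Ch. XV (Tate) §3.3] -/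
theorem map_rpMeasure_eq_rpMeasure_of_componentwise
    (hν1 : ∀ i, i ∉ S₀ → ν i (B i : Set (G i)) = 1) (hν'1 : ∀ i, i ∉ S₀ → ν' i (B' i : Set (G' i)) = 1)
    (Φ : (Πʳ i, [G i, B i]) ≃ₜ* (Πʳ i, [G' i, B' i])) (φ : ∀ i, G i → G' i) (hφm : ∀ i, Measurable (φ i))
    (hΦ : ∀ x i, Φ x i = φ i (x i)) (hφB : ∀ i, i ∉ S₀ → φ i ⁻¹' (B' i : Set (G' i)) = (B i : Set (G i)))
    (hmap : ∀ i, Measure.map (φ i) (ν i) = ν' i) :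
    Measure.map Φ (rpMeasure (fun i => (B i : Set (G i))) ν S₀) = rpMeasure (fun i => (B' i : Set (G' i))) ν' S₀ := by
  classical
  have hBm : ∀ i, MeasurableSet (B i : Set (G i)) := fun i => (hBo.out i).measurableSet
  have hB'm : ∀ i, MeasurableSet (B' i : Set (G' i)) := fun i => (hB'o.out i).measurableSet
  -- both sides are Haar measures
  haveI hR : (rpMeasure (fun i => (B i : Set (G i))) ν S₀).IsHaarMeasure :=
    isHaarMeasure_rpMeasure B S₀ (fun i => ⟨⟨(B i : Set (G i)), isCompact_iff_compactSpace.2 (hBc i)⟩, by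
      rw [(hBo.out i).interior_eq]; exact ⟨1, (B i).one_mem⟩⟩) ν
      (fun i _ => isCompact_iff_compactSpace.2 (hBc i)) hν1
  haveI hR' : (rpMeasure (fun i => (B' i : Set (G' i))) ν' S₀).IsHaarMeasure :=
    isHaarMeasure_rpMeasure B' S₀ (fun i => ⟨⟨(B' i : Set (G' i)), isCompact_iff_compactSpace.2 (hB'c i)⟩, by
      rw [(hB'o.out i).interior_eq]; exact ⟨1, (B' i).one_mem⟩⟩) ν'
      (fun i _ => isCompact_iff_compactSpace.2 (hB'c i)) hν'1
  haveI : (Measure.map Φ (rpMeasure (fun i => (B i : Set (G i))) ν S₀)).IsHaarMeasure :=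
    MulEquiv.isHaarMeasure_map _ Φ.toMulEquiv Φ.continuous Φ.symm.continuous
  -- compare on the compact open integral box `∏ B′_i`
  have hbox : IsCompact {y : Πʳ i, [G' i, B' i] | ∀ i, y i ∈ (B' i : Set (G' i))} ∧
      IsOpen {y : Πʳ i, [G' i, B' i] | ∀ i, y i ∈ (B' i : Set (G' i))} :=
    ⟨ProdL2.isCompact_boxSet (C := B'), ProdL2.isOpen_boxSet (C := B')⟩
  refine Literature.NumberTheory.Automorphic.haar_eq_of_apply_eq_of_isCompact_isOpen _ _ hbox.1 hbox.2 ⟨1, fun i => (B' i).one_mem⟩ ?_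
  have hΦm : Measurable (⇑Φ) := Φ.continuous.measurable
  rw [Measure.map_apply hΦm (measurableSet_setOf_forall_mem (fun i => (B' i : Set (G' i))) hB'm hB'm)]
  have hpre : ⇑Φ ⁻¹' {y : Πʳ i, [G' i, B' i] | ∀ i, y i ∈ (B' i : Set (G' i))} =
      {x : Πʳ i, [G i, B i] | ∀ i, x i ∈ φ i ⁻¹' (B' i : Set (G' i))} := by
    ext x; simp only [mem_preimage, mem_setOf_eq, hΦ]
  rw [hpre, rpMeasure_setOf_forall_mem_eq_prod (fun i => (B i : Set (G i))) ν (fun i => ⟨1, (B i).one_mem⟩) hBm hν1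
      (Finset.Subset.refl S₀) (fun i => (hφm i) (hB'm i)) hφB,
    rpMeasure_setOf_forall_mem_eq_prod (fun i => (B' i : Set (G' i))) ν' (fun i => ⟨1, (B' i).one_mem⟩) hB'm hν'1
      (Finset.Subset.refl S₀) hB'm (fun _ _ => rfl)]
  refine Finset.prod_congr rfl fun i _ => ?_
  rw [← hmap i, Measure.map_apply (hφm i) (hB'm i)]

end Componentwise

end Literature.MeasureTheory.RestrictedProduct
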